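import Literature.Computability.Complexity.ArthurMerlinCollapseProofs
import HarnessLib

/-!
# `AM[k] ⊆ IP[k]`: Arthur is an interactive-proof verifier (proof)

Third sibling proof file of `ArthurMerlinGames.lean` (D-0014). It DISCHARGES the named fact
`Literature.Computability.Complexity.AMk_subset_IPk` — "Clearly for every `k`, `AM[k] ⊆ IP[k]`" (Arora–Barak §8.2.1), "the
inclusion `AM(t(n)) ⊆ IP(t(n))` is immediate" (Babai–Moran 1988, §1.5) — for the tree's game
class `AMk k` (`ArthurMerlinGames.lean`) and private-coin class `IPk k` (`InteractiveProofs.lean`),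
and draws the corollaries that close the circle with the Collapse Theorem
(`ArthurMerlinCollapseProofs.lean`): `AM ⊆ IP[2]` unconditionally (`AM_subset_IPk_two`), and
`IP[k] = AM` for every constant `k ≥ 2` given Goldwasser–Sipser (`IPk_eq_AM_of_GS`).

* **Strategy form of the game value** (`playout`, `numArthur`): for every Merlin strategy
  with legal moves the average payoff over Arthur's uniformly random moves is at most the value
  (`sum_playout_le`), and Merlin's optimal strategy attains it
  (`exists_strategy_sum_playout_eq`) — BM §2.3;
* `sum_comp_injective` — summing out unused coordinates of a product space
  (`∑_{b : Fin k → α} G (b ∘ e) = |α|^{k-a} ∑_c G c` for injective `e`; `fiberEquivComplFun`);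
* **Arthur as a verifier** (`AMasIP.verifier Ref m k`): `(k+1)·m` coins, message `i` = coin
  block `i` (`AMasIP.nextF`, an `FP` brick over `Brick.foldFn`: drop `m` coins per message read,
  take `m`; `AMasIP.nextF_view`), verdict = the referee on `⟨x, enc t⟩` (`AMasIP.verdictL`);
  `transcriptAux_eq_playout` (the interaction with a prover is the play-out of the prover's
  strategy against the coin blocks at Arthur's turns), `acceptProb_eq` (acceptance
  probability = average play-out payoff: equidistribution of the blocks, `isBoardSplit_block`,
  then `sum_comp_injective` for the unused odd blocks), hence `acceptProb_le_amValue`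
  (soundness against every prover) and `exists_prover_acceptProb_eq` (completeness with the
  optimal strategy), and **`AMk_subset_IPk_holds`**.

## References

* S. Arora, B. Barak, *Computational Complexity: A Modern Approach*, CUP 2009, §8.2.1 (public
  coins: "Clearly for every `k`, `AM[k] ⊆ IP[k]`"), Def. 8.6, Def. 8.10.
* L. Babai, S. Moran, *Arthur–Merlin games …*, JCSS 36 (1988), §1.5 ("`AM(t(n)) ⊆ IP(t(n))` is
  immediate"; with [GS] and the Collapse Theorem, "`AM(t(n)) = IP(t(n))`"), §2.3.
-/

noncomputable section

namespace Literature.Computability.Complexity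

open _root_.Computability Finset AMPlayer Brick Plumb

open scoped Classical

/-! ### Strategy form of the game value -/

/-- **Playing a game out**: Merlin follows the strategy `σ` (history ↦ move), Arthur's moves are
consumed in order from the supply `ys`. [cite: BabaiMoran1988, §2.3] -/
def playout (σ : List (List Bool) → List Bool) : List AMPlayer → List (List Bool) → List (List Bool) → List (List Bool)
  | [], h, _ => h
  | arthur :: pat, h, ys => playout σ pat (h ++ [ys.headD []]) ys.tail
  | merlin :: pat, h, ys => playout σ pat (h ++ [σ h]) ys

/-- The number of Arthur moves in a move pattern. [folklore] -/
def numArthur : List AMPlayer → ℕ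
  | [] => 0
  | arthur :: pat => numArthur pat + 1
  | merlin :: pat => numArthur pat

/-- Play-out with no move left. [folklore] -/
@[simp] theorem playout_nil (σ : List (List Bool) → List Bool) (h ys : List (List Bool)) : playout σ [] h ys = h := rfl

/-- Play-out at an Arthur node with a nonempty supply. [folklore] -/
@[simp] theorem playout_arthur_cons (σ : List (List Bool) → List Bool) (pat : List AMPlayer) (h : List (List Bool))
    (y : List Bool) (ys : List (List Bool)) :
    playout σ (arthur :: pat) h (y :: ys) = playout σ pat (h ++ [y]) ys := rfl

/-- Play-out at a Merlin node. [folklore] -/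
@[simp] theorem playout_merlin (σ : List (List Bool) → List Bool) (pat : List AMPlayer) (h ys : List (List Bool)) :
    playout σ (merlin :: pat) h ys = playout σ pat (h ++ [σ h]) ys := rfl

/-- `numArthur` of the alternating patterns. [folklore] -/
@[simp] theorem numArthur_nil : numArthur [] = 0 := rfl
/-- `numArthur` at an Arthur node. [folklore] -/
@[simp] theorem numArthur_arthur (pat : List AMPlayer) : numArthur (arthur :: pat) = numArthur pat + 1 := rfl
/-- `numArthur` at a Merlin node. [folklore] -/
@[simp] theorem numArthur_merlin (pat : List AMPlayer) : numArthur (merlin :: pat) = numArthur pat := rfl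

/-- **Strategy form, upper bound**: for every Merlin strategy with legal moves, the average
payoff of the play-out over Arthur's uniformly random moves is at most the value of the game
(the value is Merlin's OPTIMAL winning chance). [cite: BabaiMoran1988, §2.3] -/
theorem sum_playout_le {m : ℕ} (f : List (List Bool) → ℝ) (σ : List (List Bool) → List Bool)
    (hσ : ∀ h, (σ h).length = m) :
    ∀ (pat : List AMPlayer) (h : List (List Bool)),
      ∑ c : Fin (numArthur pat) → List.Vector Bool m, f (playout σ pat h (List.ofFn fun j => (c j).toList)) ≤
        ((2 : ℝ) ^ m) ^ numArthur pat * gameValue f m pat h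
  | [], h => by simp
  | arthur :: pat, h => by
    rw [numArthur_arthur, sum_pi_succ_eq]
    simp only [List.ofFn_succ, Fin.cons_zero, Fin.cons_succ, playout_arthur_cons]
    calc ∑ y : List.Vector Bool m, ∑ b : Fin (numArthur pat) → List.Vector Bool m,
          f (playout σ pat (h ++ [y.toList]) (List.ofFn fun j => (b j).toList))
        ≤ ∑ y : List.Vector Bool m, ((2 : ℝ) ^ m) ^ numArthur pat * gameValue f m pat (h ++ [y.toList]) :=
          sum_le_sum fun y _ => sum_playout_le f σ hσ pat _
      _ = ((2 : ℝ) ^ m) ^ (numArthur pat + 1) * gameValue f m (arthur :: pat) h := by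
          rw [← mul_sum, gameValue_arthur, pow_succ, mul_assoc, mul_div_cancel₀ _ (by positivity)]
  | merlin :: pat, h => by
    rw [numArthur_merlin]
    simp only [playout_merlin]
    refine (sum_playout_le f σ hσ pat _).trans ?_
    exact mul_le_mul_of_nonneg_left (le_gameValue_merlin f m pat h ⟨σ h, hσ h⟩) (by positivity)

/-- **Strategy form, attained**: Merlin's optimal strategy (at every history, a move of maximal
value for the remaining pattern) achieves the value. [cite: BabaiMoran1988, §2.3] -/
theorem exists_strategy_sum_playout_eq {m : ℕ} (f : List (List Bool) → ℝ) (pat₀ : List AMPlayer) :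
    ∃ σ : List (List Bool) → List Bool, (∀ h, (σ h).length = m) ∧
      ∀ (pat : List AMPlayer) (h : List (List Bool)), pat = pat₀.drop h.length →
        ∑ c : Fin (numArthur pat) → List.Vector Bool m, f (playout σ pat h (List.ofFn fun j => (c j).toList)) =
          ((2 : ℝ) ^ m) ^ numArthur pat * gameValue f m pat h := by
  -- Merlin's optimal move at `h` for the pattern remaining after it
  have hex : ∀ h : List (List Bool), ∃ y : List.Vector Bool m,
      gameValue f m (merlin :: pat₀.drop (h.length + 1)) h = gameValue f m (pat₀.drop (h.length + 1)) (h ++ [y.toList]) :=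
    fun h => by
      obtain ⟨y, -, hy⟩ := exists_mem_eq_sup' univ_nonempty
        (fun y : List.Vector Bool m => gameValue f m (pat₀.drop (h.length + 1)) (h ++ [y.toList]))
      exact ⟨y, by rw [gameValue_merlin, hy]⟩
  choose y hy using hex
  refine ⟨fun h => (y h).toList, fun h => (y h).toList_length, ?_⟩
  intro pat
  induction pat with
  | nil => intro h _; simp
  | cons p pat ih =>
    intro h hpat
    have hpat' : pat = pat₀.drop (h.length + 1) := by
      rw [← List.tail_drop, ← hpat]; rfl
    cases p
    · rw [numArthur_arthur, sum_pi_succ_eq]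
      simp only [List.ofFn_succ, Fin.cons_zero, Fin.cons_succ, playout_arthur_cons]
      have IH : ∀ yv : List.Vector Bool m, ∑ b : Fin (numArthur pat) → List.Vector Bool m,
          f (playout (fun h => (y h).toList) pat (h ++ [yv.toList]) (List.ofFn fun j => (b j).toList)) =
            ((2 : ℝ) ^ m) ^ numArthur pat * gameValue f m pat (h ++ [yv.toList]) := fun yv =>
        ih (h ++ [yv.toList]) (by rw [List.length_append, List.length_singleton]; exact hpat')
      simp_rw [IH]
      rw [← mul_sum, gameValue_arthur, pow_succ, mul_assoc, mul_div_cancel₀ _ (by positivity)]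
    · rw [numArthur_merlin]
      simp only [playout_merlin]
      rw [ih (h ++ [(y h).toList]) (by rw [List.length_append, List.length_singleton]; exact hpat')]
      have hyh := hy h
      rw [← hpat'] at hyh
      rw [hyh]

/-! ### Summing out unused coordinates -/

/-- The functions `b` on `Fin k` with prescribed values `c` along an injective `e : Fin a → Fin k`
correspond to the functions on the complement of the range of `e`. [folklore] -/
def fiberEquivComplFun {α : Type*} [Nonempty α] {a k : ℕ} (e : Fin a → Fin k) (he : Function.Injective e)
    (c : Fin a → α) : {b : Fin k → α // b ∘ e = c} ≃ ({i : Fin k // i ∉ Set.range e} → α) where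
  toFun b := fun i => b.1 i.1
  invFun g := ⟨Function.extend e c (fun i => if h : i ∉ Set.range e then g ⟨i, h⟩ else Classical.arbitrary α),
    funext fun j => show Function.extend e c _ (e j) = c j from he.extend_apply _ _ j⟩
  left_inv b := by
    apply Subtype.ext
    funext i
    show Function.extend e c (fun i => if h : i ∉ Set.range e then b.1 i else Classical.arbitrary α) i = b.1 i
    by_cases h : ∃ j, e j = i
    · obtain ⟨j, rfl⟩ := h
      rw [he.extend_apply]
      exact (congr_fun b.2 j).symm
    · rw [Function.extend_apply' _ _ _ h, dif_pos (show i ∉ Set.range e from fun hr => h hr)]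
  right_inv g := by
    funext i
    show Function.extend e c (fun i => if h : i ∉ Set.range e then g ⟨i, h⟩ else Classical.arbitrary α) i.1 = g i
    rw [Function.extend_apply' _ _ _ (fun hr => i.2 hr), dif_pos (show i.1 ∉ Set.range e from i.2)]

/-- **Summing out unused coordinates**: for an injective `e : Fin a → Fin k`,
`∑_{b : Fin k → α} G (b ∘ e) = |α|^(k-a) ∑_{c : Fin a → α} G c`. [folklore] -/
theorem sum_comp_injective {α : Type*} [Fintype α] [Nonempty α] {a k : ℕ} (e : Fin a → Fin k)
    (he : Function.Injective e) (G : (Fin a → α) → ℝ) :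
    ∑ b : Fin k → α, G (b ∘ e) = (Fintype.card α : ℝ) ^ (k - a) * ∑ c : Fin a → α, G c := by
  rw [← sum_fiberwise (univ : Finset (Fin k → α)) (fun b => b ∘ e) (fun b => G (b ∘ e)), mul_sum]
  refine sum_congr rfl fun c _ => ?_
  have hconst : ∀ b ∈ univ.filter (fun b : Fin k → α => b ∘ e = c), G (b ∘ e) = G c := fun b hb => by
    rw [(mem_filter.1 hb).2]
  rw [sum_congr rfl hconst, sum_const, nsmul_eq_mul]
  congr 1
  have hcard : (univ.filter (fun b : Fin k → α => b ∘ e = c)).card = Fintype.card {b : Fin k → α // b ∘ e = c} := by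
    rw [Fintype.card_subtype]
  have hr : Fintype.card {i : Fin k // i ∈ Set.range e} = a := by
    have h1 := Set.card_range_of_injective he
    rw [Fintype.card_fin] at h1
    convert h1
  rw [hcard, Fintype.card_congr (fiberEquivComplFun e he c), Fintype.card_fun, Fintype.card_subtype_compl,
    Fintype.card_fin, hr]
  push_cast
  rfl

/-! ### Arthur as an interactive-proof verifier -/

namespace AMasIP

variable (Ref : Language Bool) (m : Polynomial ℕ)

/-- Fold step reading the transcript: per message read, drop `m(|x|)` coins
(`⟨⟨⟨x, r⟩, L⟩, ⟨a, acc⟩⟩ ↦ acc ⇂ m(|x|)`). [folklore] -/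
def dropAccStep : List Bool → List Bool :=
  dropFn ∘ fanoutFn (polyFn m ∘ fstF ∘ fstF ∘ nthF 0) (sndPow 1)

/-- The coins not yet used: `⟨⟨x, r⟩, encList t⟩ ↦ r ⇂ (m(|x|) · |t|)`. [folklore] -/
def restCoinsF : List Bool → List Bool := foldFn (dropAccStep m) (sndF ∘ fstF)

/-- Rearranging the view `⟨x, ⟨r, ⟨1^{|t|}, encList t⟩⟩⟩` into `⟨⟨x, r⟩, encList t⟩`. [folklore] -/
def rearrF : List Bool → List Bool := fanoutFn (fanoutFn fstF (nthF 1)) (sndPow 2)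

/-- **Arthur's next message**: the next unused block of `m(|x|)` coins,
`view ↦ (r ⇂ (m(|x|)·|t|)) ↾ m(|x|)` (one block per message exchanged; the blocks at Merlin's
turns stay unused). [cite: AroraBarakCC2009, §8.2.1] -/
def nextF : List Bool → List Bool := takeFn ∘ fanoutFn (polyFn m ∘ fstF) (restCoinsF m ∘ rearrF)

/-- **Arthur's verdict**: the referee on `⟨x, enc t⟩` (the coins are public — they are the
transcript's own messages — so the verdict ignores `r`). [cite: AroraBarakCC2009, §8.2.1] -/
def verdictL : Language Bool := (fanoutFn fstF (sndPow 1)) ⁻¹' Ref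

/-- **Arthur, as a verifier** for `k` messages: `(k+1)·m` coins, messages of length `m`.
[cite: AroraBarakCC2009, §8.2.1] [cite: BabaiMoran1988, §1.5] -/
def verifier (k : ℕ) : IPVerifier :=
  ⟨((k : Polynomial ℕ) + 1) * m, m, nextF m, verdictL Ref⟩

/-- The fields of Arthur's verifier (stated as rewriting lemmas: the field values are large
`FP` terms that must not be unfolded by definitional unification). [folklore] -/
theorem verifier_next (k : ℕ) : (verifier Ref m k).next = nextF m := by
  simp only [verifier]
/-- The fields of Arthur's verifier. [folklore] -/
theorem verifier_verdict (k : ℕ) : (verifier Ref m k).verdict = verdictL Ref := by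
  simp only [verifier]
/-- The fields of Arthur's verifier. [folklore] -/
theorem verifier_msgLen (k : ℕ) : (verifier Ref m k).msgLen = m := by
  simp only [verifier]
/-- The fields of Arthur's verifier. [folklore] -/
theorem verifier_coins (k : ℕ) (n : ℕ) : (verifier Ref m k).coins.eval n = (k + 1) * m.eval n := by
  simp only [verifier]
  simp

/-- One step of the interaction, the verifier speaking. [cite: AroraBarakCC2009, Def. 8.6] -/
theorem transcriptAux_true_succ (V : IPVerifier) (x r : List Bool) (P : IPProver) (mh k : ℕ) (t : List (List Bool)) :
    V.transcriptAux x r P mh true (k + 1) t = V.transcriptAux x r P mh false k (t ++ [(V.next (IPVerifier.view x r t)).takeD mh false]) :=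
  rfl

/-- One step of the interaction, the prover speaking. [cite: AroraBarakCC2009, Def. 8.6] -/
theorem transcriptAux_false_succ (V : IPVerifier) (x r : List Bool) (P : IPProver) (mh k : ℕ) (t : List (List Bool)) :
    V.transcriptAux x r P mh false (k + 1) t = V.transcriptAux x r P mh true k (t ++ [(P t).takeD mh false]) :=
  rfl

/-- No step left. [cite: AroraBarakCC2009, Def. 8.6] -/
theorem transcriptAux_zero (V : IPVerifier) (x r : List Bool) (P : IPProver) (mh : ℕ) (b : Bool) (t : List (List Bool)) :
    V.transcriptAux x r P mh b 0 t = t := by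
  cases b <;> rfl

/-- `dropAccStep` on a step argument. [folklore] -/
theorem dropAccStep_apply (x r L a acc : List Bool) :
    dropAccStep m (boolPair (boolPair (boolPair x r) L) (boolPair a acc)) = acc.drop (m.eval x.length) := by
  simp [dropAccStep, nthF, sndPow, ones]

/-- `dropAccStep ∈ FP`. [folklore] -/
theorem dropAccStep_mem_FP : dropAccStep m ∈ FP :=
  comp_mem_FP dropFn_mem_FP (fanoutFn_mem_FP
    (comp_mem_FP (polyFn_mem_FP m) (comp_mem_FP fstF_mem_FP (comp_mem_FP fstF_mem_FP (nthF_mem_FP 0))))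
    (sndPow_mem_FP 1))

/-- Growth of `dropAccStep`: the accumulator only shrinks. [folklore] -/
theorem foldGrowth_dropAccStep : FoldGrowth 0 (dropAccStep m) := fun v => by
  have h : dropAccStep m v = (sndPow 1 v).drop ((polyFn m ∘ fstF ∘ fstF ∘ nthF 0) v).length := by
    simp [dropAccStep]
  rw [h, List.length_drop]
  simp only [sndPow, nthF, Function.comp_apply]
  omega

/-- `nextF ∈ FP`. [folklore] -/
theorem nextF_mem_FP : nextF m ∈ FP :=
  comp_mem_FP takeFn_mem_FP (fanoutFn_mem_FP (comp_mem_FP (polyFn_mem_FP m) fstF_mem_FP)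
    (comp_mem_FP (foldFn_mem_FP (dropAccStep_mem_FP m) (comp_mem_FP sndF_mem_FP fstF_mem_FP) (foldGrowth_dropAccStep m))
      (fanoutFn_mem_FP (fanoutFn_mem_FP fstF_mem_FP (nthF_mem_FP 1)) (sndPow_mem_FP 2))))

variable {Ref} in
/-- `verdictL Ref ∈ P` for `Ref ∈ P`. [folklore] -/
theorem verdictL_mem_P (hRef : Ref ∈ Classes.P) : verdictL Ref ∈ Classes.P :=
  preimage_mem_P hRef (fanoutFn_mem_FP fstF_mem_FP (sndPow_mem_FP 1))

/-- **Arthur's next message is the next coin block**: on the view of a transcript `t`,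
`nextF` returns block `|t|` (of length `m(|x|)`) of the coins. [cite: AroraBarakCC2009, §8.2.1] -/
theorem nextF_view (x r : List Bool) (t : List (List Bool)) :
    nextF m (IPVerifier.view x r t) = block (m.eval x.length) t.length r := by
  have hfold : ∀ (l : List (List Bool)) (acc : List Bool),
      l.foldl (fun acc a => dropAccStep m (boolPair (boolPair (boolPair x r) (encList t)) (boolPair a acc))) acc =
        acc.drop (m.eval x.length * l.length) := by
    intro l
    induction l with
    | nil => intro acc; simp
    | cons a l ih =>
      intro acc
      rw [List.foldl_cons, dropAccStep_apply, ih, List.drop_drop, List.length_cons, Nat.mul_succ, Nat.add_comm]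
  have hview : IPVerifier.view x r t = boolPair x (boolPair r (boolPair (ones t.length) (encList t))) := by
    rw [← Boards.encMoves_eq]; rfl
  rw [hview]
  simp only [nextF, rearrF, restCoinsF, Function.comp_apply, fanoutFn_apply, fstF_boolPair, nthF_succ_boolPair,
    nthF_zero_boolPair, sndPow_succ_boolPair, sndPow_zero_boolPair, polyFn_apply, foldFn_boolPair, decNil_encList,
    sndF_boolPair, hfold, takeFn_boolPair, block, Nat.mul_comm]
  simp [ones]

/-- The verdict reads the referee. [cite: AroraBarakCC2009, §8.2.1] -/
theorem view_mem_verdictL_iff (x r : List Bool) (t : List (List Bool)) :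
    IPVerifier.view x r t ∈ verdictL Ref ↔ boolPair x (encMoves t) ∈ Ref := by
  show fanoutFn fstF (sndPow 1) (boolPair x (boolPair r (encMoves t))) ∈ Ref ↔ _
  simp [sndPow]

/-- **Arthur's future moves**, read off the coins: the blocks at history lengths
`s, s+2, …, s+2(n-1)`. [folklore] -/
def coinBlocks (mh : ℕ) (r : List Bool) (s n : ℕ) : List (List Bool) :=
  List.ofFn fun j : Fin n => block mh (s + 2 * j) r

/-- Peeling the first block. [folklore] -/
theorem coinBlocks_succ (mh : ℕ) (r : List Bool) (s n : ℕ) :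
    coinBlocks mh r s (n + 1) = block mh s r :: coinBlocks mh r (s + 2) n := by
  simp only [coinBlocks, List.ofFn_succ, Fin.val_zero, Fin.val_succ, Nat.mul_zero, Nat.add_zero]
  congr 1
  exact congrArg List.ofFn (funext fun j => by rw [show s + 2 * ((j : ℕ) + 1) = s + 2 + 2 * (j : ℕ) by ring])

/-- The Merlin strategy underlying a prover: its messages, normalised to length `m(|x|)`.
[cite: AroraBarakCC2009, Def. 8.6] -/
def proverStrategy (mh : ℕ) (P : IPProver) : List (List Bool) → List Bool := fun h => (P h).takeD mh false

/-- The prover strategy plays legal moves. [folklore] -/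
theorem length_proverStrategy (mh : ℕ) (P : IPProver) (h : List (List Bool)) :
    (proverStrategy mh P h).length = mh := List.takeD_length _ _ _

/-- `numArthur` along the alternating patterns. [folklore] -/
theorem numArthur_alternate_arthur_succ (k : ℕ) :
    numArthur (arthur.alternate (k + 1)) = numArthur (merlin.alternate k) + 1 := by
  rw [AMPlayer.alternate_succ, AMPlayer.other_arthur, numArthur_arthur]

/-- `numArthur` along the alternating patterns. [folklore] -/
theorem numArthur_alternate_merlin_succ (k : ℕ) :
    numArthur (merlin.alternate (k + 1)) = numArthur (arthur.alternate k) := by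
  rw [AMPlayer.alternate_succ, AMPlayer.other_merlin, numArthur_merlin]

/-- At most every other move is Arthur's: `2 · numArthur (arthur.alternate k) ≤ k + 1`. [folklore] -/
theorem two_mul_numArthur_le (k : ℕ) : 2 * numArthur (arthur.alternate k) ≤ k + 1 := by
  induction k using Nat.strong_induction_on with
  | _ k ih =>
    match k with
    | 0 => simp
    | 1 => simp [numArthur]
    | k + 2 =>
      rw [alternate_add_two, List.cons_append, List.cons_append, List.nil_append, numArthur_arthur, numArthur_merlin]
      have := ih k (by omega)
      omega

/-- **The interaction of Arthur with a prover is a play-out**: Arthur's moves are the coin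
blocks at the history lengths of his turns, Merlin follows the prover's strategy. (With enough
coins: every block at a history length `< K` is full.) [cite: AroraBarakCC2009, §8.2.1] -/
theorem transcriptAux_eq_playout (k₀ : ℕ) (x r : List Bool) (P : IPProver) {K : ℕ}
    (hr : ∀ i < K, (block (m.eval x.length) i r).length = m.eval x.length) :
    ∀ (k : ℕ) (h : List (List Bool)), h.length + k ≤ K →
      (verifier Ref m k₀).transcriptAux x r P (m.eval x.length) true k h =
          playout (proverStrategy (m.eval x.length) P) (arthur.alternate k) h
            (coinBlocks (m.eval x.length) r h.length (numArthur (arthur.alternate k))) ∧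
        (verifier Ref m k₀).transcriptAux x r P (m.eval x.length) false k h =
          playout (proverStrategy (m.eval x.length) P) (merlin.alternate k) h
            (coinBlocks (m.eval x.length) r (h.length + 1) (numArthur (merlin.alternate k))) := by
  intro k
  induction k with
  | zero =>
    intro h _
    simp only [transcriptAux_zero, AMPlayer.alternate_zero, playout_nil, and_self]
  | succ k ih =>
    intro h hK
    refine ⟨?_, ?_⟩
    · -- Arthur speaks: his message is the coin block at `|h|`
      have hnext : (nextF m (IPVerifier.view x r h)).takeD (m.eval x.length) false =
          block (m.eval x.length) h.length r := by
        rw [nextF_view, List.takeD_eq_take _ (hr h.length (by omega)).ge, List.take_of_length_le (hr h.length (by omega)).le]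
      rw [transcriptAux_true_succ, verifier_next, hnext,
        (ih (h ++ [block (m.eval x.length) h.length r]) (by simp; omega)).2,
        numArthur_alternate_arthur_succ, coinBlocks_succ, AMPlayer.alternate_succ, AMPlayer.other_arthur,
        playout_arthur_cons, List.length_append, List.length_singleton]
    · -- Merlin speaks: the prover's strategy
      rw [transcriptAux_false_succ, (ih (h ++ [(P h).takeD (m.eval x.length) false]) (by simp; omega)).1,
        numArthur_alternate_merlin_succ, AMPlayer.alternate_succ, AMPlayer.other_merlin, playout_merlin,
        List.length_append, List.length_singleton]
      rfl

/-- **The transcript is the play-out from the root** (coins `r` with all `k` leading blocks full).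
[cite: AroraBarakCC2009, §8.2.1] -/
theorem transcript_eq_playout (k : ℕ) (x r : List Bool) (P : IPProver)
    (hr : ∀ i < k, (block (m.eval x.length) i r).length = m.eval x.length) :
    (verifier Ref m k).transcript k x r P =
      playout (proverStrategy (m.eval x.length) P) (arthur.alternate k) []
        (coinBlocks (m.eval x.length) r 0 (numArthur (arthur.alternate k))) :=
  by
    have h := (transcriptAux_eq_playout Ref m k x r P hr k [] (by simp)).1
    simpa [IPVerifier.transcript, verifier_msgLen] using h

/-- **Arthur's acceptance probability against a prover is the average payoff of the play-out
of the prover's strategy** over Arthur's uniformly random moves. [cite: BabaiMoran1988, §1.5] -/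
theorem acceptProb_eq (k : ℕ) (x : List Bool) (P : IPProver) :
    (verifier Ref m k).acceptProb k x P =
      (∑ c : Fin (numArthur (arthur.alternate k)) → List.Vector Bool (m.eval x.length),
        refereePayoff Ref x (playout (proverStrategy (m.eval x.length) P) (arthur.alternate k) []
          (List.ofFn fun j => (c j).toList))) / ((2 : ℝ) ^ m.eval x.length) ^ numArthur (arthur.alternate k) := by
  set mh := m.eval x.length with hmh
  set a := numArthur (arthur.alternate k) with ha
  set σ := proverStrategy mh P with hσ
  have hcoins : (verifier Ref m k).coins.eval x.length = (k + 1) * mh := by rw [verifier_coins]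
  -- the even-position embedding of Arthur's `a` turns among the `k + 1` coin blocks
  have hlt : ∀ j : Fin a, 2 * (j : ℕ) < k + 1 := fun j => by
    have h1 := two_mul_numArthur_le k; have h2 := j.isLt; omega
  set e : Fin a → Fin (k + 1) := fun j => ⟨2 * (j : ℕ), hlt j⟩ with he
  have heinj : Function.Injective e := fun j j' hjj' => Fin.ext (by
    have := congrArg Fin.val hjj'; simp only [he] at this; omega)
  -- (1) acceptance as a counting probability of the play-out payoff
  have h1 : (verifier Ref m k).acceptProb k x P =
      (∑ r : List.Vector Bool ((k + 1) * mh), refereePayoff Ref x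
        (playout σ (arthur.alternate k) [] (coinBlocks mh r.toList 0 a))) / 2 ^ ((k + 1) * mh) := by
    unfold IPVerifier.acceptProb
    rw [hcoins, uniformProb_eq_cnt_div, cnt]
    congr 1
    rw [Finset.natCast_card_filter]
    refine sum_congr rfl fun r _ => ?_
    have hr : ∀ i < k, (block mh i r.toList).length = mh := fun i hi =>
      length_block (by rw [r.toList_length]; nlinarith)
    rw [Set.mem_setOf_eq, IPVerifier.Accepts, verifier_verdict, view_mem_verdictL_iff,
      transcript_eq_playout Ref m k x r.toList P hr, refereePayoff_eq_ite]
  -- (2) equidistribution of the coin blocks, then sum out the unused (odd) blocks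
  have h2 : ∑ r : List.Vector Bool ((k + 1) * mh), refereePayoff Ref x
      (playout σ (arthur.alternate k) [] (coinBlocks mh r.toList 0 a)) =
        ((2 : ℝ) ^ mh) ^ (k + 1 - a) * ∑ c : Fin a → List.Vector Bool mh,
          refereePayoff Ref x (playout σ (arthur.alternate k) [] (List.ofFn fun j => (c j).toList)) := by
    have hsplit := (isBoardSplit_block_of_le (le_refl ((k + 1) * mh))).equi
      (fun cb : Fin (k + 1) → List Bool => refereePayoff Ref x (playout σ (arthur.alternate k) []
        (List.ofFn fun j => cb (e j))))
    simp only [Nat.sub_self, pow_zero, one_mul] at hsplit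
    have hcb : ∀ r : List.Vector Bool ((k + 1) * mh), coinBlocks mh r.toList 0 a =
        List.ofFn fun j => block mh (e j) r.toList := fun r => by
      simp [coinBlocks, he]
    simp_rw [hcb]
    rw [hsplit]
    have hsc := sum_comp_injective e heinj (fun c : Fin a → List.Vector Bool mh =>
      refereePayoff Ref x (playout σ (arthur.alternate k) [] (List.ofFn fun j => (c j).toList)))
    rw [card_moves] at hsc
    push_cast at hsc
    exact hsc
  rw [h1, h2]
  have hpow : (2 : ℝ) ^ ((k + 1) * mh) = ((2 : ℝ) ^ mh) ^ (k + 1 - a) * ((2 : ℝ) ^ mh) ^ a := by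
    rw [← pow_add, Nat.sub_add_cancel (by have h1 := two_mul_numArthur_le k; omega), ← pow_mul, Nat.mul_comm]
  rw [hpow, mul_div_mul_left _ _ (by positivity)]

/-- **Soundness of Arthur**: against every prover, Arthur accepts with probability at most the
value of the game. [cite: BabaiMoran1988, §1.5] [cite: AroraBarakCC2009, §8.2.1] -/
theorem acceptProb_le_amValue (k : ℕ) (x : List Bool) (P : IPProver) :
    (verifier Ref m k).acceptProb k x P ≤ amValue Ref (m.eval x.length) (arthur.alternate k) x := by
  rw [acceptProb_eq, div_le_iff₀ (by positivity)]
  unfold amValue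
  rw [mul_comm]
  exact sum_playout_le (refereePayoff Ref x) _ (length_proverStrategy _ P) (arthur.alternate k) []

/-- **Completeness of Arthur**: the prover playing Merlin's optimal strategy is accepted with
probability exactly the value of the game. [cite: BabaiMoran1988, §1.5] [cite: AroraBarakCC2009, §8.2.1] -/
theorem exists_prover_acceptProb_eq (k : ℕ) (x : List Bool) :
    ∃ P : IPProver, (verifier Ref m k).acceptProb k x P = amValue Ref (m.eval x.length) (arthur.alternate k) x := by
  obtain ⟨σ, hσ, hsum⟩ := exists_strategy_sum_playout_eq (m := m.eval x.length) (refereePayoff Ref x) (arthur.alternate k)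
  refine ⟨σ, ?_⟩
  have hP : proverStrategy (m.eval x.length) σ = σ := funext fun h => by
    rw [proverStrategy, List.takeD_eq_take _ (hσ h).ge, List.take_of_length_le (hσ h).le]
  rw [acceptProb_eq, hP, hsum (arthur.alternate k) [] (by simp), mul_div_cancel_left₀ _ (by positivity)]
  rfl

end AMasIP

/-- **`AM[k] ⊆ IP[k]` (discharge of the named fact `AMk_subset_IPk`)**: Arthur — his messages
the successive blocks of his coins, his verdict the referee's — is a probabilistic
polynomial-time verifier, complete against Merlin's optimal strategy and sound against every
prover because no strategy beats the value of the game ("Clearly `AM[k] ⊆ IP[k]`", Arora–Barak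
§8.2.1; "immediate", Babai–Moran §1.5). [cite: AroraBarakCC2009, §8.2.1] [cite: BabaiMoran1988, §1.5] -/
theorem AMk_subset_IPk_holds : AMk_subset_IPk := fun k L hL => by
  obtain ⟨Ref, hRef, m, hL⟩ := (mem_AMGames_iff.1 hL : ∃ Ref ∈ Classes.P, ∃ m : Polynomial ℕ, ∀ x : List Bool,
    (x ∈ L → (2 / 3 : ℝ) ≤ amValue Ref (m.eval x.length) (arthur.alternate k) x) ∧
      (x ∉ L → amValue Ref (m.eval x.length) (arthur.alternate k) x ≤ 1 / 3))
  refine ⟨AMasIP.verifier Ref m k, ?_, fun x => ⟨fun hx => ?_, fun hx P => ?_⟩⟩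
  · show (AMasIP.verifier Ref m k).next ∈ FP ∧ (AMasIP.verifier Ref m k).verdict ∈ Classes.P
    rw [AMasIP.verifier_next, AMasIP.verifier_verdict]
    exact ⟨AMasIP.nextF_mem_FP m, AMasIP.verdictL_mem_P hRef⟩
  · obtain ⟨P, hP⟩ := AMasIP.exists_prover_acceptProb_eq Ref m k x
    refine ⟨P, ?_⟩
    show (2 / 3 : ℝ) ≤ (AMasIP.verifier Ref m k).acceptProb k x P
    rw [hP]
    exact (hL x).1 hx
  · show (AMasIP.verifier Ref m k).acceptProb k x P ≤ 1 / 3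
    exact (AMasIP.acceptProb_le_amValue Ref m k x P).trans ((hL x).2 hx)

/-- **`AM ⊆ IP[2]`**, unconditionally (from `AM = AM(2)` and `AM(2) ⊆ IP(2)`, both proved).
[cite: BabaiMoran1988, §1.5] -/
theorem AM_subset_IPk_two : AM ⊆ IPk 2 :=
  AM_subset_IPk_two_of AMk_two_eq_AM_holds AMk_subset_IPk_holds

/-- **`IP[k] = AM` for every constant `k ≥ 2`, given Goldwasser–Sipser** (`IP[k] ⊆ AM` by
`IPk_subset_AM_of_GS`; `AM ⊆ IP[2] ⊆ IP[k]`… here in the form `AM ⊆ IP[k]` via `AM = AM(k) ⊆ IP(k)`).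
[cite: BabaiMoran1988, §1.5 ("AM(t(n)) = IP(t(n))")] -/
theorem IPk_eq_AM_of_GS (hGS : GoldwasserSipser1986_IPk_subset_AMk) {k : ℕ} (hk : 2 ≤ k) : IPk k = AM := by
  refine Set.Subset.antisymm (IPk_subset_AM_of_GS hGS k) ?_
  rw [← AMk_two_eq_AM_holds, ← (BabaiMoran1988_collapse_holds k hk).1]
  exact AMk_subset_IPk_holds k


end Literature.Computability.Complexity

end
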